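import Summits.Ventures.PercRepro.C041TriDomSharingS1Merge

/-!
# ROW C-041 — THE ASYMMETRIC SHARING S1: the `(x, z)`-two-mark domination on «`y` blue-isolated» has slack at least
the class `(s₃, s₁)`, on every up-set of every status (p6, gen 48; P6-TWOEXIT-LEAN.md §53 ADDENDUM 22)

Marks: the anchor `a₁ = x` and the exits `u = y`, `u' = z`; patterns `P3 = (x ~ y, x ~ z, y ~ z)`.  THE STATEMENT
(`cntS1_nonneg`, `sharing_S1` for the all-free host): for every up-set `V` of colourings,
   `#(V ∩ (⊥,s₂)) + #(V ∩ (s₁,s₂)) + #(V ∩ (s₃,s₂)) + #(V ∩ (s₃,s₁)) ≤ #(V ∩ (s₂,⊥)) + #(V ∩ (⊤,⊥))`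
— the colourings with «`x ~_B z` only, `y` blue-isolated, `x ≁_R z`» together with those of the class
«`y ~_R z` only, `x ~_B y` only» are outnumbered by «`x ~_R z`, all three blue-separated».  It contains the one-mark-edge
statement `C_xy` of ADDENDUM 20 (drop `(s₃,s₂)` on the left), hence CONJECTURE (STOCHASTIC DOMINATION) on every host
with the mark edge `xy`.

PROOF.  The deletion–contraction induction of `cntB_le_cntR` with ONE twist: the free edge `f` is chosen TOUCHING THE
DOUBLE-COMPONENT of the anchor (`dblCompS`, module `C041TriDomSharingS1Merge`).  (A) If no free edge touches it, the
red and the blue cluster of `x` both equal the component for every colouring (`RdS_iff_dblComp`, `MgS_iff_dblComp`),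
so every class of S1 is empty (`S1F_sig_eq_zero`) and the count is `0` (`cntS1_eq_zero`).  (B) Otherwise the merges at
`f` are x-merges in both colours (`xmerge_rsig`, `xmerge_bsig`), and with the up-set sliced at `f` (`V_R ⊇ V_B`) the
recursion `2·cntS1 st V = Σ_{V_R} S1F(σ',τ) + Σ_{V_B} S1F(σ,τ')` (`cntS1_rec`) is bounded below, pointwise by the key
inequalities (`S1F_ind_ineq`), by the induction hypothesis at the deletion on `V_R` and at the contraction on `V_B`
(`cntS1_step`).  The general single merge `⊥ → s₃` (an edge joining the clusters of `y` and `z` away from `x`) is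
exactly where the key inequalities fail — the choice of `f` avoids it.
-/


namespace PercRepro

namespace ZoneZ

namespace MultiExit

open ZoneData Finset

variable {V₁ E₁ U₁ U₂ : Type} (Z₁ : ZoneData V₁ E₁ U₁ U₂) (u u' a₁ : V₁)

variable [DecidableEq E₁]

/-! ## No free edge at the anchor's double-component: both clusters of the anchor are the component -/

omit [DecidableEq E₁] in
/-- Without a free edge touching the double-component of `a₁`, the red cluster of `a₁` is that component. -/
theorem RdS_iff_dblComp (st : E₁ → EStat)
    (hA : ∀ e, st e = .free → ¬ (Z₁.fst e ∈ dblCompS Z₁ st a₁ ∨ Z₁.snd e ∈ dblCompS Z₁ st a₁))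
    (ω : E₁ → Bool) (v : V₁) : RdS Z₁ st ω a₁ v ↔ v ∈ dblCompS Z₁ st a₁ := by
  constructor
  · intro h
    unfold RdS at h
    rw [mem_reach_singleton] at h
    unfold dblCompS
    rw [mem_reach_singleton]
    induction h with
    | refl => exact Relation.ReflTransGen.refl
    | @tail c w _ hcw ih =>
      obtain ⟨e, he, hr⟩ := hcw
      rcases hr with hd | ⟨hfree, _⟩
      · exact ih.tail ⟨e, he, hd⟩
      · exfalso
        apply hA e hfree
        have hc : c ∈ dblCompS Z₁ st a₁ := by
          unfold dblCompS
          rw [mem_reach_singleton]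
          exact ih
        rcases he with ⟨h1, _⟩ | ⟨_, h2⟩
        · rw [h1]; exact Or.inl hc
        · rw [h2]; exact Or.inr hc
  · intro h
    exact RdS_of_mem_dblComp Z₁ st ω h

omit [DecidableEq E₁] in
/-- Without a free edge touching the double-component of `a₁`, the blue cluster of `a₁` is that component. -/
theorem MgS_iff_dblComp (st : E₁ → EStat)
    (hA : ∀ e, st e = .free → ¬ (Z₁.fst e ∈ dblCompS Z₁ st a₁ ∨ Z₁.snd e ∈ dblCompS Z₁ st a₁))
    (ω : E₁ → Bool) (v : V₁) : MgS Z₁ st ω a₁ v ↔ v ∈ dblCompS Z₁ st a₁ := by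
  constructor
  · intro h
    unfold MgS at h
    rw [mem_reach_singleton] at h
    unfold dblCompS
    rw [mem_reach_singleton]
    induction h with
    | refl => exact Relation.ReflTransGen.refl
    | @tail c w _ hcw ih =>
      obtain ⟨e, he, hb⟩ := hcw
      rcases hb with hd | ⟨hfree, _⟩
      · exact ih.tail ⟨e, he, hd⟩
      · exfalso
        apply hA e hfree
        have hc : c ∈ dblCompS Z₁ st a₁ := by
          unfold dblCompS
          rw [mem_reach_singleton]
          exact ih
        rcases he with ⟨h1, _⟩ | ⟨_, h2⟩
        · rw [h1]; exact Or.inl hc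
        · rw [h2]; exact Or.inr hc
  · intro h
    exact MgS_of_mem_dblComp Z₁ st ω h

omit [DecidableEq E₁] in
open Classical in
/-- Without a free edge at the anchor's double-component every summand of S1 vanishes. -/
theorem S1F_sig_eq_zero (st : E₁ → EStat)
    (hA : ∀ e, st e = .free → ¬ (Z₁.fst e ∈ dblCompS Z₁ st a₁ ∨ Z₁.snd e ∈ dblCompS Z₁ st a₁))
    (ω : E₁ → Bool) : S1F (rsig Z₁ u u' a₁ st ω) (bsig Z₁ u u' a₁ st ω) = 0 := by
  apply S1F_eq_zero_of_anchor_eq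
  · simp only [rsig, bsig, decide_eq_decide]
    rw [RdS_iff_dblComp Z₁ a₁ st hA, MgS_iff_dblComp Z₁ a₁ st hA]
  · simp only [rsig, bsig, decide_eq_decide]
    rw [RdS_iff_dblComp Z₁ a₁ st hA, MgS_iff_dblComp Z₁ a₁ st hA]

/-! ## The patterns at a free edge, by its colour -/

/-- A red free edge: the red pattern is the contraction's. -/
theorem rsig_of_true_S1 {st : E₁ → EStat} {f : E₁} (hf : st f = .free) {ω : E₁ → Bool} (hω : ω f = true) :
    rsig Z₁ u u' a₁ st ω = rsig Z₁ u u' a₁ (Function.update st f .double) ω :=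
  rsig_congr Z₁ u u' a₁ (RAdjS_of_true Z₁ hf hω)

/-- A blue free edge: the red pattern is the deletion's. -/
theorem rsig_of_false_S1 {st : E₁ → EStat} {f : E₁} (hf : st f = .free) {ω : E₁ → Bool} (hω : ω f = false) :
    rsig Z₁ u u' a₁ st ω = rsig Z₁ u u' a₁ (Function.update st f .absent) ω :=
  rsig_congr Z₁ u u' a₁ (RAdjS_of_false Z₁ hf hω)

/-- A red free edge: the blue pattern is the deletion's. -/
theorem bsig_of_true_S1 {st : E₁ → EStat} {f : E₁} (hf : st f = .free) {ω : E₁ → Bool} (hω : ω f = true) :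
    bsig Z₁ u u' a₁ st ω = bsig Z₁ u u' a₁ (Function.update st f .absent) ω :=
  bsig_congr Z₁ u u' a₁ (BAdjS_of_true Z₁ hf hω)

/-- A blue free edge: the blue pattern is the contraction's. -/
theorem bsig_of_false_S1 {st : E₁ → EStat} {f : E₁} (hf : st f = .free) {ω : E₁ → Bool} (hω : ω f = false) :
    bsig Z₁ u u' a₁ st ω = bsig Z₁ u u' a₁ (Function.update st f .double) ω :=
  bsig_congr Z₁ u u' a₁ (BAdjS_of_false Z₁ hf hω)

/-- A non-free edge ignores the flip of its colour (red pattern). -/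
theorem rsig_flip_nonfree (st : E₁ → EStat) (f : E₁) {s : EStat} (hs : s ≠ .free) (ω : E₁ → Bool) :
    rsig Z₁ u u' a₁ (Function.update st f s) (flipC f ω) = rsig Z₁ u u' a₁ (Function.update st f s) ω :=
  rsig_congr Z₁ u u' a₁ (RAdjS_update_nonfree Z₁ st f hs ω _)

/-- A non-free edge ignores the flip of its colour (blue pattern). -/
theorem bsig_flip_nonfree (st : E₁ → EStat) (f : E₁) {s : EStat} (hs : s ≠ .free) (ω : E₁ → Bool) :
    bsig Z₁ u u' a₁ (Function.update st f s) (flipC f ω) = bsig Z₁ u u' a₁ (Function.update st f s) ω :=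
  bsig_congr Z₁ u u' a₁ (BAdjS_update_nonfree Z₁ st f hs ω _)

/-! ## The count of a pattern functional and its recursion -/

variable [Fintype E₁]

open Classical in
/-- The count of a pattern functional `F` over a family `V` of colourings of a status:
`Σ_{ω ∈ V} F (red pattern ω) (blue pattern ω)`. -/
noncomputable def cntF (F : P3 → P3 → ℤ) (st : E₁ → EStat) (V : (E₁ → Bool) → Prop) : ℤ :=
  ∑ ω : E₁ → Bool, if V ω then F (rsig Z₁ u u' a₁ st ω) (bsig Z₁ u u' a₁ st ω) else 0

omit [Fintype E₁] in
open Classical in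
/-- The summand at `ω` and at the flip of a free edge `f`: the red slice sees the contraction in red and the deletion
in blue, the blue slice the other way round. -/
theorem F_summand_add_flip (F : P3 → P3 → ℤ) (st : E₁ → EStat) (f : E₁) (hf : st f = .free)
    (V : (E₁ → Bool) → Prop) (ω : E₁ → Bool) :
    ((if V ω then F (rsig Z₁ u u' a₁ st ω) (bsig Z₁ u u' a₁ st ω) else 0)
      + (if V (flipC f ω) then F (rsig Z₁ u u' a₁ st (flipC f ω)) (bsig Z₁ u u' a₁ st (flipC f ω)) else 0) : ℤ) =
      (if sliceV V f true ω then
          F (rsig Z₁ u u' a₁ (Function.update st f .double) ω) (bsig Z₁ u u' a₁ (Function.update st f .absent) ω)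
        else 0)
        + (if sliceV V f false ω then
            F (rsig Z₁ u u' a₁ (Function.update st f .absent) ω)
              (bsig Z₁ u u' a₁ (Function.update st f .double) ω)
          else 0) := by
  have hd : EStat.double ≠ EStat.free := by decide
  have ha : EStat.absent ≠ EStat.free := by decide
  have h3 : V ω ↔ sliceV V f (ω f) ω := (sliceV_self V f ω).symm
  have h4 : V (flipC f ω) ↔ sliceV V f (!ω f) ω := Iff.rfl
  cases hω : ω f
  · have hω' : flipC f ω f = true := by simp [flipC_apply_self, hω]
    rw [rsig_of_false_S1 Z₁ u u' a₁ hf hω, bsig_of_false_S1 Z₁ u u' a₁ hf hω,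
      rsig_of_true_S1 Z₁ u u' a₁ hf hω', bsig_of_true_S1 Z₁ u u' a₁ hf hω',
      rsig_flip_nonfree Z₁ u u' a₁ st f hd, bsig_flip_nonfree Z₁ u u' a₁ st f ha]
    rw [hω] at h3 h4
    simp only [Bool.not_false] at h4
    rw [if_congr h3 rfl rfl, if_congr h4 rfl rfl]
    ring
  · have hω' : flipC f ω f = false := by simp [flipC_apply_self, hω]
    rw [rsig_of_true_S1 Z₁ u u' a₁ hf hω, bsig_of_true_S1 Z₁ u u' a₁ hf hω,
      rsig_of_false_S1 Z₁ u u' a₁ hf hω', bsig_of_false_S1 Z₁ u u' a₁ hf hω',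
      rsig_flip_nonfree Z₁ u u' a₁ st f ha, bsig_flip_nonfree Z₁ u u' a₁ st f hd]
    rw [hω] at h3 h4
    simp only [Bool.not_true] at h4
    rw [if_congr h3 rfl rfl, if_congr h4 rfl rfl]

open Classical in
/-- **The recursion of the count of a pattern functional at a free edge.** -/
theorem cntF_rec (F : P3 → P3 → ℤ) (st : E₁ → EStat) (f : E₁) (hf : st f = .free) (V : (E₁ → Bool) → Prop) :
    2 * cntF Z₁ u u' a₁ F st V =
      (∑ ω : E₁ → Bool, if sliceV V f true ω then
          F (rsig Z₁ u u' a₁ (Function.update st f .double) ω) (bsig Z₁ u u' a₁ (Function.update st f .absent) ω)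
        else 0)
        + ∑ ω : E₁ → Bool, if sliceV V f false ω then
            F (rsig Z₁ u u' a₁ (Function.update st f .absent) ω)
              (bsig Z₁ u u' a₁ (Function.update st f .double) ω)
          else 0 := by
  unfold cntF
  rw [two_mul_sum_eq_flip, ← Finset.sum_add_distrib]
  exact Finset.sum_congr rfl fun ω _ => F_summand_add_flip Z₁ u u' a₁ F st f hf V ω

/-- The S1 count of a status on a family of colourings: `Σ_{ω ∈ V} S1F (red pattern) (blue pattern)`
`= #(V ∩ (s₂,⊥)) + #(V ∩ (⊤,⊥)) − #(V ∩ (⊥,s₂)) − #(V ∩ (s₁,s₂)) − #(V ∩ (s₃,s₂)) − #(V ∩ (s₃,s₁))`. -/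
noncomputable abbrev cntS1 (st : E₁ → EStat) (V : (E₁ → Bool) → Prop) : ℤ := cntF Z₁ u u' a₁ S1F st V

open Classical in
/-- **The recursion of the S1 count at a free edge.** -/
theorem cntS1_rec (st : E₁ → EStat) (f : E₁) (hf : st f = .free) (V : (E₁ → Bool) → Prop) :
    2 * cntS1 Z₁ u u' a₁ st V =
      (∑ ω : E₁ → Bool, if sliceV V f true ω then
          S1F (rsig Z₁ u u' a₁ (Function.update st f .double) ω) (bsig Z₁ u u' a₁ (Function.update st f .absent) ω)
        else 0)
        + ∑ ω : E₁ → Bool, if sliceV V f false ω then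
            S1F (rsig Z₁ u u' a₁ (Function.update st f .absent) ω)
              (bsig Z₁ u u' a₁ (Function.update st f .double) ω)
          else 0 :=
  cntF_rec Z₁ u u' a₁ S1F st f hf V

open Classical in
/-- **The induction step**: at a free edge touching the anchor's double-component, the recursion's two sums dominate
the S1 counts of the deletion on the red slice and of the contraction on the blue slice. -/
theorem cntS1_step (st : E₁ → EStat) (f : E₁) (hf : st f = .free)
    (hT : Z₁.fst f ∈ dblCompS Z₁ st a₁ ∨ Z₁.snd f ∈ dblCompS Z₁ st a₁) {V : (E₁ → Bool) → Prop} (hV : UpSet V) :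
    cntS1 Z₁ u u' a₁ (Function.update st f .absent) (sliceV V f true)
        + cntS1 Z₁ u u' a₁ (Function.update st f .double) (sliceV V f false) ≤
      (∑ ω : E₁ → Bool, if sliceV V f true ω then
          S1F (rsig Z₁ u u' a₁ (Function.update st f .double) ω) (bsig Z₁ u u' a₁ (Function.update st f .absent) ω)
        else 0)
        + ∑ ω : E₁ → Bool, if sliceV V f false ω then
            S1F (rsig Z₁ u u' a₁ (Function.update st f .absent) ω)
              (bsig Z₁ u u' a₁ (Function.update st f .double) ω)
          else 0 := by
  unfold cntS1 cntF
  rw [← Finset.sum_add_distrib, ← Finset.sum_add_distrib]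
  refine Finset.sum_le_sum fun ω _ => ?_
  exact S1F_ind_ineq _ _ (sliceV_false_le hV f ω) _ _ _ _ (trans3_rsig Z₁ u u' a₁ _ ω) (trans3_rsig Z₁ u u' a₁ _ ω)
    (trans3_bsig Z₁ u u' a₁ _ ω) (trans3_bsig Z₁ u u' a₁ _ ω) (xmerge_rsig Z₁ u u' a₁ hf hT ω)
    (xmerge_bsig Z₁ u u' a₁ hf hT ω)

open Classical in
/-- Without a free edge at the anchor's double-component the S1 count vanishes. -/
theorem cntS1_eq_zero (st : E₁ → EStat)
    (hA : ∀ e, st e = .free → ¬ (Z₁.fst e ∈ dblCompS Z₁ st a₁ ∨ Z₁.snd e ∈ dblCompS Z₁ st a₁))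
    (V : (E₁ → Bool) → Prop) : cntS1 Z₁ u u' a₁ st V = 0 := by
  unfold cntS1 cntF
  refine Finset.sum_eq_zero fun ω _ => ?_
  rw [S1F_sig_eq_zero Z₁ u u' a₁ st hA ω]
  simp

open Classical in
/-- **THEOREM (THE ASYMMETRIC SHARING S1), status form**: on every up-set of colourings of every status,
`#(⊥,s₂) + #(s₁,s₂) + #(s₃,s₂) + #(s₃,s₁) ≤ #(s₂,⊥) + #(⊤,⊥)` — induction on the number of free edges, the free
edge chosen at the anchor's double-component. -/
theorem cntS1_nonneg (st : E₁ → EStat) {V : (E₁ → Bool) → Prop} (hV : UpSet V) :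
    0 ≤ cntS1 Z₁ u u' a₁ st V := by
  suffices h : ∀ n : ℕ, ∀ st : E₁ → EStat, nfree st = n → ∀ V : (E₁ → Bool) → Prop, UpSet V →
      0 ≤ cntS1 Z₁ u u' a₁ st V from h _ st rfl V hV
  intro n
  induction n with
  | zero =>
    intro st hst V _
    have hno : ∀ e, st e ≠ .free := by
      intro e he
      have : e ∈ (univ.filter fun e => st e = .free) := by simp [he]
      rw [Finset.card_eq_zero.mp hst] at this
      exact absurd this (Finset.notMem_empty e)
    rw [cntS1_eq_zero Z₁ u u' a₁ st (fun e he _ => hno e he) V]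
  | succ n ih =>
    intro st hst V hV
    by_cases hex : ∃ f, st f = .free ∧ (Z₁.fst f ∈ dblCompS Z₁ st a₁ ∨ Z₁.snd f ∈ dblCompS Z₁ st a₁)
    · obtain ⟨f, hf, hT⟩ := hex
      have ha := ih (Function.update st f .absent) (by
        have := nfree_update hf (s := .absent) (by decide); omega) (sliceV V f true) (upSet_sliceV hV f true)
      have hd := ih (Function.update st f .double) (by
        have := nfree_update hf (s := .double) (by decide); omega) (sliceV V f false) (upSet_sliceV hV f false)
      have hR := cntS1_rec Z₁ u u' a₁ st f hf V
      have hS := cntS1_step Z₁ u u' a₁ st f hf hT hV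
      linarith
    · have hA : ∀ e, st e = .free → ¬ (Z₁.fst e ∈ dblCompS Z₁ st a₁ ∨ Z₁.snd e ∈ dblCompS Z₁ st a₁) :=
        fun e he h => hex ⟨e, he, h⟩
      rw [cntS1_eq_zero Z₁ u u' a₁ st hA V]

/-! ## The all-free host: the six classes -/

/-- The left-hand classes of S1 on the host: `(⊥,s₂) ∪ (s₁,s₂) ∪ (s₃,s₂)` (`x ~_B z` only, `x ≁_R z`) and `(s₃,s₁)`
(`y ~_R z` only, `x ~_B y` only), in the host's connectivities `Rd` / `Mg`. -/
def S1Left (ω : E₁ → Bool) : Prop :=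
  (¬ Z₁.Rd a₁ u' ω ∧ Z₁.Mg a₁ u' ω ∧ ¬ Z₁.Mg a₁ u ω ∧ ¬ Z₁.Mg u u' ω) ∨
    (Z₁.Rd u u' ω ∧ ¬ Z₁.Rd a₁ u ω ∧ ¬ Z₁.Rd a₁ u' ω ∧ Z₁.Mg a₁ u ω ∧ ¬ Z₁.Mg a₁ u' ω ∧ ¬ Z₁.Mg u u' ω)

/-- The right-hand classes of S1 on the host: `(s₂,⊥) ∪ (⊤,⊥)` (`x ~_R z`, all three blue-separated). -/
def S1Right (ω : E₁ → Bool) : Prop :=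
  Z₁.Rd a₁ u' ω ∧ ¬ Z₁.Mg a₁ u ω ∧ ¬ Z₁.Mg a₁ u' ω ∧ ¬ Z₁.Mg u u' ω

omit [DecidableEq E₁] [Fintype E₁] in
open Classical in
/-- The functional on the all-free host is the difference of the two class indicators. -/
theorem S1F_free (ω : E₁ → Bool) :
    S1F (rsig Z₁ u u' a₁ (fun _ => EStat.free) ω) (bsig Z₁ u u' a₁ (fun _ => EStat.free) ω) =
      (if S1Right Z₁ u u' a₁ ω then 1 else 0) - (if S1Left Z₁ u u' a₁ ω then 1 else 0) := by
  have hr : ∀ k v, RdS Z₁ (fun _ => EStat.free) ω k v ↔ Z₁.Rd k v ω := fun k v => RdS_free Z₁ ω k v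
  have hb : ∀ k v, MgS Z₁ (fun _ => EStat.free) ω k v ↔ Z₁.Mg k v ω := fun k v => MgS_free Z₁ ω k v
  have ht := trans3_rsig Z₁ u u' a₁ (fun _ => EStat.free) ω
  have ht' := trans3_bsig Z₁ u u' a₁ (fun _ => EStat.free) ω
  simp only [rsig, bsig, Trans3, decide_eq_true_eq] at ht ht'
  simp only [S1F, rsig, bsig, S1Right, S1Left, Prod.mk.injEq, decide_eq_true_eq, decide_eq_false_iff_not, hr, hb]
  simp only [hr, hb] at ht ht'
  by_cases h1 : Z₁.Rd a₁ u ω <;> by_cases h2 : Z₁.Rd a₁ u' ω <;> by_cases h3 : Z₁.Rd u u' ω <;>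
    by_cases h4 : Z₁.Mg a₁ u ω <;> by_cases h5 : Z₁.Mg a₁ u' ω <;> by_cases h6 : Z₁.Mg u u' ω <;>
    simp_all

open Classical in
/-- **THEOREM (THE ASYMMETRIC SHARING S1)**: for every up-set `V` of colourings of a finite host with marks
`x = a₁`, `y = u`, `z = u'`,
`#{ω ∈ V : (x ~_B z only, y blue-isolated, x ≁_R z) ∨ (y ~_R z only, x ~_B y only)} ≤ #{ω ∈ V : x ~_R z, blue ⊥}`. -/
theorem sharing_S1 {V : (E₁ → Bool) → Prop} (hV : UpSet V) :
    (univ.filter fun ω : E₁ → Bool => V ω ∧ S1Left Z₁ u u' a₁ ω).card ≤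
      (univ.filter fun ω : E₁ → Bool => V ω ∧ S1Right Z₁ u u' a₁ ω).card := by
  have h := cntS1_nonneg Z₁ u u' a₁ (fun _ => EStat.free) hV
  unfold cntS1 cntF at h
  simp only [S1F_free] at h
  rw [Finset.card_filter, Finset.card_filter]
  have hsum : ∀ (P : (E₁ → Bool) → Prop),
      (∑ ω : E₁ → Bool, if V ω ∧ P ω then (1 : ℕ) else 0 : ℕ) =
        ∑ ω : E₁ → Bool, if V ω then (if P ω then (1 : ℕ) else 0) else 0 := by
    intro P
    refine Finset.sum_congr rfl fun ω _ => ?_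
    by_cases hv : V ω <;> by_cases hp : P ω <;> simp [hv, hp]
  rw [hsum, hsum]
  have hz : ((∑ ω : E₁ → Bool, if V ω then (if S1Left Z₁ u u' a₁ ω then (1 : ℕ) else 0) else 0 : ℕ) : ℤ) ≤
      ((∑ ω : E₁ → Bool, if V ω then (if S1Right Z₁ u u' a₁ ω then (1 : ℕ) else 0) else 0 : ℕ) : ℤ) := by
    push_cast
    have : (∑ ω : E₁ → Bool, if V ω then
        ((if S1Right Z₁ u u' a₁ ω then (1 : ℤ) else 0) - (if S1Left Z₁ u u' a₁ ω then 1 else 0)) else 0) =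
        (∑ ω : E₁ → Bool, if V ω then (if S1Right Z₁ u u' a₁ ω then (1 : ℤ) else 0) else 0)
          - ∑ ω : E₁ → Bool, if V ω then (if S1Left Z₁ u u' a₁ ω then (1 : ℤ) else 0) else 0 := by
      rw [← Finset.sum_sub_distrib]
      refine Finset.sum_congr rfl fun ω _ => ?_
      by_cases hv : V ω <;> simp [hv]
    rw [this] at h
    linarith
  exact_mod_cast hz

end MultiExit

end ZoneZ

end PercRepro
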